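import Summits.MatrixMultiplication.OmegaCensus.ThreeSetLineModFourSlice
import Summits.MatrixMultiplication.OmegaCensus.ThreeSetLineNormFilterDefs
import HarnessLib

/-!
# The bit-sliced MOD-4 FILTER, VI: the block checker with declared exceptions (definitions)

ω-census `pub-omega`, family (b3), seat pub-omega-group gen 42.  Framing: lottery ticket; floor = certified bounds/negative
ranges.  VALUE: a kernel TOOL for the three-set cube cells `(4, d, e)@p²` (`ThreeSetZpCells4Core`); NOT progress on ω.
`blockChkX`: as `LineMod.blockChk`, but the (rare, accidental) survivors of the sliced mod-4 filter may be DECLARED by index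
and datum; a declared datum is pinned to the block planes by its two low bit-planes (entries `≤ 3`, length `p`, sum `d`:
`excChk`) and must be killed by the certificate-free norm filter `LineNorm.normBlockX` (`ThreeSetLineNormFilterDefs`).
Measured for `(4,7,10)@841`: 15 survivors among 4 × 6 724 520 data (11 / 2 / 1 / 1 per killer), none a solution, all
norm-filter dead without unit certificates.  Soundness: `ThreeSetLineModFourSliceExcSound`.
-/

namespace Summit.MatrixMultiplication.OmegaCensus

/-! # The block checker with declared exceptions (survivors of the sliced filter, killed by the norm filter) -/

namespace LineMod

/-- The mask of the declared exception indices. [folklore] -/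
def excMask : List (ℕ × List ℕ) → ℕ
  | [] => 0
  | kF :: es => excMask es ||| 2 ^ kF.1

/-- A declared exception `(k, F)`: `F` has length `p`, sum `d`, entries `≤ 3`, and its two low bit-planes agree with the block
planes at datum `k` — which pins the `k`-th datum of the block to be `F`. [folklore] -/
def excChk (p d : ℕ) (PL : List (List ℕ)) (kF : ℕ × List ℕ) : Bool :=
  (kF.2.length == p) && (kF.2.sum == d) &&
  (List.range p).all fun i => (kF.2.getD i 0 ≤ 3 : Bool) &&
    (((PL.getD i []).getD 0 0).testBit kF.1 == (kF.2.getD i 0).testBit 0) &&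
    (((PL.getD i []).getD 1 0).testBit kF.1 == (kF.2.getD i 0).testBit 1)

/-- **The block checker with exceptions.**  As `blockChk`, but the survivors of the sliced mod-4 filter may be DECLARED
(`exc`: index and datum) — they must then be killed by the certificate-free norm filter `LineNorm.normBlockX` of
`ThreeSetLineNormFilterDefs` (parameters `nB nX nM g gi dlog st ms uexc` as there; `uexc` = unit certificates for data
surviving even that). [folklore] -/
def blockChkX (p K d e : ℕ) (W pre : List ℕ) (n j : ℕ) (sched : List Bool) (exc : List (ℕ × List ℕ))
    (nB nX nM g gi : ℕ) (dlog : List ℕ) (st : List Bool) (ms : List ℤ)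
    (uexc : List (List ℕ × List (ℕ × ℕ × ℕ × ℕ))) : Bool :=
  let B := blockPlanes pre n j
  let ones := onesOf B.1
  (0 < p : Bool) && (3 * p < 256 : Bool) && (W.length == p) && (pre.length + n == p) && (pre.sum + j == d) &&
  (0 < W.sum * d : Bool) && (3 * (W.sum * d) * e + 1 == p * K) &&
  (exc.all (excChk p d B.2)) &&
  (survMask p ones K e W (sdigits p B.2) sched ||| excMask exc == excMask exc) &&
  LineNorm.normBlockX p nB nX nM g gi dlog st d W (exc.map (·.2)) ms uexc

end LineMod

end Summit.MatrixMultiplication.OmegaCensus
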